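import Summits.QuantumFields.QCD.Theorems.SpectralDefectExtinctionWegnerEstimateCoareaSlice
import Summits.QuantumFields.QCD.Theorems.SpectralDefectExtinctionWegnerEstimateCoareaBookkeeping
import Summits.QuantumFields.QCD.Theorems.SpectralDefectExtinctionWegnerEstimateCoareaClusterDerivative
import Summits.QuantumFields.QCD.Theorems.SpectralDefectExtinctionWegnerEstimateCoareaWeylLipschitz

/-!
# Bridge lemma N₁ toward stub `coareaWegner` of line `Sketch` (skeleton "ResolventCell", gen 2) for
crux `SpectralDefectExtinction.WegnerEstimate` (item stmt-QuantumFields-8966):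
the CANONICAL CIRCLE MAJORANT — a measurable, branch-free level-velocity weight

The current sum `G_d(V) = Σ_j [|λ_j| ≤ 1] |J_d(u_j)| φ_ε(λ_j)` produced by the rigidity insertion
(bridge G) is written in Mathlib's (chosen) eigenbasis `u_j` of `H(V)` and is not known to be
measurable in `V`.  This file replaces it, almost everywhere and from above, by the CANONICAL weight

  `R_d(V) = Σ_i |∂_s|_{s=0} Λ_i(H(V[e ↦ V(e) c(s)]))| · φ(Λ_i(H(V)))`

built from the decreasingly SORTED eigenvalues `Λ_i = eigenvalues₀` along the one-link circle of
direction `d = (e, c)` through `V`.  In an abstract setting (compact second-countable group `G`,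
configurations `V : ι → G` with product Haar measure, a continuous Hermitian-valued `H`, a continuous
one-parameter subgroup `c`, and a "current" `J(V, ψ) = d/ds|₀ re ⟨ψ, H(V[e ↦ V(e)c(s)]) ψ⟩`):

* `coareaWegner_majorant_measurable` — `R_d` is measurable (joint continuity of the sorted eigenvalues,
  Weyl; measurability of parametric derivatives, `measurable_deriv_with_param`);
* `coareaWegner_majorant_ae_dominates` — for a.e. `V` (product Haar), for Mathlib's eigenpairs
  `(u_j, λ_j)` of `H(V)`: `Σ_j |J(V, u_j)| φ(λ_j) = R_d(V)` (cluster Hellmann–Feynman, bridge I, at the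
  configurations where all sorted eigenvalues are differentiable along the circle; these are almost
  all by Lebesgue's theorem along each circle and the slice lemma, bridge F);
* `coareaWegner_majorant_circle_lintegral` — along the circle through any `V`,
  `∫⁻_{(0,2π]} R_d(V[e ↦ V(e)c(t)]) dt ≤ Σ_i ∫⁻_{[0,2π]} |Λ_i'| φ(Λ_i)` (reparametrisation by the group law),
  which the area bound (bridge M) controls uniformly.
-/

noncomputable section

namespace Summit.QuantumFields.QCD.Cruxes.WegnerEstimate.ResolventCell

open MeasureTheory Filter
open scoped Matrix BigOperators ENNReal NNReal Topology InnerProductSpace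
open Literature.MathematicalPhysics.QuantumLattice Literature.MathematicalPhysics.QuantumFieldTheory
  Literature.Probability.LatticeModels
open Matrix
open scoped ComplexOrder

section General

variable {Y : Type*} [TopologicalSpace Y] {n : Type*} [Fintype n] [DecidableEq n]

/-- **Sorted eigenvalues of a continuous Hermitian-valued map are continuous** (Weyl, entrywise). -/
theorem coareaWegner_continuous_eigenvalues₀_comp {A : Y → Matrix n n ℂ} (hA : Continuous A)
    (hHerm : ∀ y, (A y).IsHermitian) (i : Fin (Fintype.card n)) :
    Continuous fun y => (hHerm y).eigenvalues₀ i := by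
  refine continuous_iff_continuousAt.2 fun y₀ => ?_
  rw [ContinuousAt, Metric.tendsto_nhds]
  intro ε hε
  -- entries are jointly close near `y₀`
  set δ : ℝ := ε / (2 * (Fintype.card n + 1)) with hδ
  have hδpos : 0 < δ := by positivity
  have hent : ∀ p q : n, ∀ᶠ y in 𝓝 y₀, ‖A y p q - A y₀ p q‖ < δ := fun p q => by
    have hc : Continuous fun y => A y p q := (continuous_apply q).comp ((continuous_apply p).comp hA)
    have := Metric.tendsto_nhds.1 (hc.tendsto y₀) δ hδpos
    simpa [dist_eq_norm] using this
  have hall : ∀ᶠ y in 𝓝 y₀, ∀ p q : n, ‖A y p q - A y₀ p q‖ < δ := by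
    simpa using (Finset.univ : Finset n).eventually_all.2 fun p _ =>
      (Finset.univ : Finset n).eventually_all.2 fun q _ => hent p q
  filter_upwards [hall] with y hy
  have hbound := coareaWegner_abs_eigenvalues₀_sub_le_of_entry (hHerm y) (hHerm y₀) hδpos.le
    (fun p q => by rw [Matrix.sub_apply]; exact (hy p q).le) i
  rw [Real.dist_eq]
  calc |(hHerm y).eigenvalues₀ i - (hHerm y₀).eigenvalues₀ i| ≤ Fintype.card n * δ := hbound
    _ < ε := by
        rw [hδ, mul_div_assoc']
        rw [div_lt_iff₀ (by positivity)]
        nlinarith [hε, (Nat.cast_nonneg (Fintype.card n) : (0 : ℝ) ≤ Fintype.card n)]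

/-- A unit vector of Mathlib's orthonormal eigenbasis satisfies `u⋆ u = 1`. -/
theorem coareaWegner_star_dotProduct_eigenvectorBasis {A : Matrix n n ℂ} (hA : A.IsHermitian) (j : n) :
    star (⇑(hA.eigenvectorBasis j)) ⬝ᵥ ⇑(hA.eigenvectorBasis j) = 1 := by
  have h := (hA.eigenvectorBasis).orthonormal.1 j
  have h2 : ⟪hA.eigenvectorBasis j, hA.eigenvectorBasis j⟫_ℂ = 1 := by
    rw [inner_self_eq_norm_sq_to_K, h]; simp
  rw [EuclideanSpace.inner_eq_star_dotProduct, dotProduct_comm] at h2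
  exact h2

end General

section CircleMajorant

variable {G : Type*} [Group G] [TopologicalSpace G] [IsTopologicalGroup G] [CompactSpace G]
  [MeasurableSpace G] [BorelSpace G] [SecondCountableTopology G]
  {ι : Type*} [Fintype ι] [DecidableEq ι] {n : Type*} [Fintype n] [DecidableEq n]

omit [TopologicalSpace G] [IsTopologicalGroup G] [CompactSpace G] [MeasurableSpace G] [BorelSpace G]
  [SecondCountableTopology G] [Fintype ι] in
/-- Reparametrisation of one-link circles by the group law: moving by `t` and then by `s` is moving
by `t + s`. -/
theorem coareaWegner_update_update (e : ι) {c : ℝ → G} (hmul : ∀ s t, c (s + t) = c s * c t)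
    (V : ι → G) (t s : ℝ) :
    Function.update (Function.update V e (V e * c t)) e ((Function.update V e (V e * c t)) e * c s) =
      Function.update V e (V e * c (t + s)) := by
  rw [Function.update_idem, Function.update_self, hmul, mul_assoc]

omit [TopologicalSpace G] [IsTopologicalGroup G] [CompactSpace G] [MeasurableSpace G] [BorelSpace G]
  [SecondCountableTopology G] [Fintype ι] in
/-- At parameter `0` the circle passes through `V`. -/
theorem coareaWegner_update_zero (e : ι) {c : ℝ → G} (hc0 : c 0 = 1) (V : ι → G) :
    Function.update V e (V e * c 0) = V := by
  rw [hc0, mul_one, Function.update_eq_self]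

variable (e : ι) {c : ℝ → G} (Hof : (ι → G) → Matrix n n ℂ) (hHerm : ∀ V, (Hof V).IsHermitian)

omit [TopologicalSpace G] [IsTopologicalGroup G] [CompactSpace G] [MeasurableSpace G] [BorelSpace G]
  [SecondCountableTopology G] [Fintype ι] in
/-- The sorted eigenvalue functions along the circle through `V[e ↦ V(e)c(t)]` are the shifts by `t`
of those along the circle through `V`. -/
theorem coareaWegner_sortedAlong_shift (hmul : ∀ s t, c (s + t) = c s * c t) (V : ι → G) (t : ℝ)
    (i : Fin (Fintype.card n)) :
    (fun s => (hHerm (Function.update (Function.update V e (V e * c t)) e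
        ((Function.update V e (V e * c t)) e * c s))).eigenvalues₀ i) =
      fun s => (hHerm (Function.update V e (V e * c (t + s)))).eigenvalues₀ i := by
  funext s
  exact congrArg (fun V' => (hHerm V').eigenvalues₀ i) (coareaWegner_update_update e hmul V t s)

omit [CompactSpace G] [MeasurableSpace G] [BorelSpace G] [SecondCountableTopology G] [Fintype ι] in
/-- Joint continuity of `(V, s) ↦ Λ_i(H(V[e ↦ V(e)c(s)]))`. -/
theorem coareaWegner_sortedAlong_continuous (hcont : Continuous c) (hHof : Continuous Hof)
    (i : Fin (Fintype.card n)) :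
    Continuous (Function.uncurry fun (V : ι → G) (s : ℝ) =>
      (hHerm (Function.update V e (V e * c s))).eigenvalues₀ i) := by
  have hupd : Continuous fun p : (ι → G) × ℝ => Function.update p.1 e (p.1 e * c p.2) :=
    continuous_fst.update e (((continuous_apply e).comp continuous_fst).mul (hcont.comp continuous_snd))
  have h := coareaWegner_continuous_eigenvalues₀_comp
    (A := fun p : (ι → G) × ℝ => Hof (Function.update p.1 e (p.1 e * c p.2))) (hHof.comp hupd)
    (fun p => hHerm (Function.update p.1 e (p.1 e * c p.2))) i
  rw [Function.uncurry_def]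
  exact h

omit [CompactSpace G] [MeasurableSpace G] [BorelSpace G] [SecondCountableTopology G] [Fintype ι] in
/-- Continuity in `s` of `Λ_i(H(V[e ↦ V(e)c(s)]))` for fixed `V`. -/
theorem coareaWegner_sortedAlong_continuous_right (hcont : Continuous c) (hHof : Continuous Hof)
    (V : ι → G) (i : Fin (Fintype.card n)) :
    Continuous fun s : ℝ => (hHerm (Function.update V e (V e * c s))).eigenvalues₀ i := by
  have hupd : Continuous fun s : ℝ => Function.update V e (V e * c s) :=
    continuous_const.update e (continuous_const.mul hcont)
  exact coareaWegner_continuous_eigenvalues₀_comp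
    (A := fun s : ℝ => Hof (Function.update V e (V e * c s))) (hHof.comp hupd)
    (fun s => hHerm (Function.update V e (V e * c s))) i

omit [CompactSpace G] in
/-- Measurability of the parametric level velocity `V ↦ ∂_s|_{s=0} Λ_i(H(V[e ↦ V(e)c(s)]))`. -/
theorem coareaWegner_measurable_deriv_sortedAlong (hcont : Continuous c)
    (hHof : Continuous Hof) (i : Fin (Fintype.card n)) :
    Measurable fun V : ι → G =>
      deriv (fun s => (hHerm (Function.update V e (V e * c s))).eigenvalues₀ i) 0 := by
  have h := measurable_deriv_with_param
    (f := fun (V : ι → G) (s : ℝ) => (hHerm (Function.update V e (V e * c s))).eigenvalues₀ i)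
    (coareaWegner_sortedAlong_continuous e Hof hHerm hcont hHof i)
  have hg : Measurable (fun V : ι → G => (V, (0 : ℝ))) := measurable_id.prodMk measurable_const
  have heq : (fun V : ι → G =>
      deriv (fun s => (hHerm (Function.update V e (V e * c s))).eigenvalues₀ i) 0) =
      (fun p : (ι → G) × ℝ =>
        deriv (fun s => (hHerm (Function.update p.1 e (p.1 e * c s))).eigenvalues₀ i) p.2) ∘
        (fun V : ι → G => (V, (0 : ℝ))) := rfl
  rw [heq]
  exact Measurable.comp h hg

omit [CompactSpace G] in
/-- **The canonical circle majorant is measurable.** -/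
theorem coareaWegner_majorant_measurable (hcont : Continuous c) (hHof : Continuous Hof)
    (φ : ℝ → ℝ) (hφ : Continuous φ) :
    Measurable fun V : ι → G => ENNReal.ofReal (∑ i : Fin (Fintype.card n),
      |deriv (fun s => (hHerm (Function.update V e (V e * c s))).eigenvalues₀ i) 0| *
        φ ((hHerm V).eigenvalues₀ i)) := by
  refine ENNReal.measurable_ofReal.comp (Finset.measurable_sum _ fun i _ => ?_)
  have h1 : Measurable fun V : ι → G =>
      |deriv (fun s => (hHerm (Function.update V e (V e * c s))).eigenvalues₀ i) 0| := by
    simpa only [Real.norm_eq_abs] using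
      (coareaWegner_measurable_deriv_sortedAlong e Hof hHerm hcont hHof i).norm
  have h2 : Measurable fun V : ι → G => φ ((hHerm V).eigenvalues₀ i) :=
    (hφ.comp (coareaWegner_continuous_eigenvalues₀_comp hHof hHerm i)).measurable
  exact h1.mul h2

omit [CompactSpace G] [MeasurableSpace G] [BorelSpace G] [SecondCountableTopology G] [Fintype ι] in
/-- **The circle integral of the majorant is the sum of the level-velocity integrals.**  Along the
circle through `V`, `∫⁻_{(0,2π]} R_d(V[e ↦ V(e)c(t)]) dt ≤ Σ_i ∫⁻_{[0,2π]} |Λ_i'(t)| φ(Λ_i(t)) dt` with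
`Λ_i(t) = eigenvalues₀ (H(V[e ↦ V(e)c(t)])) i`. -/
theorem coareaWegner_majorant_circle_lintegral (hmul : ∀ s t, c (s + t) = c s * c t)
    (hcont : Continuous c) (hHof : Continuous Hof) (φ : ℝ → ℝ) (hφ : Continuous φ)
    (hφ0 : ∀ E, 0 ≤ φ E) (V : ι → G) :
    ∫⁻ t in Set.Ioc 0 (2 * Real.pi), ENNReal.ofReal (∑ i : Fin (Fintype.card n),
      |deriv (fun s => (hHerm (Function.update (Function.update V e (V e * c t)) e
          ((Function.update V e (V e * c t)) e * c s))).eigenvalues₀ i) 0| *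
        φ ((hHerm (Function.update V e (V e * c t))).eigenvalues₀ i)) ≤
      ∑ i : Fin (Fintype.card n), ∫⁻ t in Set.Icc 0 (2 * Real.pi),
        ENNReal.ofReal (|deriv (fun s => (hHerm (Function.update V e (V e * c s))).eigenvalues₀ i) t| *
          φ ((hHerm (Function.update V e (V e * c t))).eigenvalues₀ i)) := by
  have hderiv : ∀ (i : Fin (Fintype.card n)) (t : ℝ),
      deriv (fun s => (hHerm (Function.update (Function.update V e (V e * c t)) e
        ((Function.update V e (V e * c t)) e * c s))).eigenvalues₀ i) 0 =
      deriv (fun s => (hHerm (Function.update V e (V e * c s))).eigenvalues₀ i) t := by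
    intro i t
    rw [coareaWegner_sortedAlong_shift e Hof hHerm hmul V t i,
      deriv_comp_const_add (f := fun s => (hHerm (Function.update V e (V e * c s))).eigenvalues₀ i) t 0,
      add_zero]
  have hmeas : ∀ i : Fin (Fintype.card n), Measurable fun t : ℝ => ENNReal.ofReal
      (|deriv (fun s => (hHerm (Function.update V e (V e * c s))).eigenvalues₀ i) t| *
        φ ((hHerm (Function.update V e (V e * c t))).eigenvalues₀ i)) := by
    intro i
    have hc' := coareaWegner_sortedAlong_continuous_right e Hof hHerm hcont hHof V i
    have h1 : Measurable fun t : ℝ =>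
        |deriv (fun s => (hHerm (Function.update V e (V e * c s))).eigenvalues₀ i) t| := by
      simpa only [Real.norm_eq_abs] using
        (measurable_deriv (fun s => (hHerm (Function.update V e (V e * c s))).eigenvalues₀ i)).norm
    exact ENNReal.measurable_ofReal.comp (h1.mul (hφ.comp hc').measurable)
  simp_rw [hderiv]
  calc ∫⁻ t in Set.Ioc 0 (2 * Real.pi), ENNReal.ofReal (∑ i : Fin (Fintype.card n),
        |deriv (fun s => (hHerm (Function.update V e (V e * c s))).eigenvalues₀ i) t| *
          φ ((hHerm (Function.update V e (V e * c t))).eigenvalues₀ i))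
      = ∫⁻ t in Set.Ioc 0 (2 * Real.pi), ∑ i : Fin (Fintype.card n), ENNReal.ofReal
          (|deriv (fun s => (hHerm (Function.update V e (V e * c s))).eigenvalues₀ i) t| *
            φ ((hHerm (Function.update V e (V e * c t))).eigenvalues₀ i)) := by
        refine lintegral_congr fun t => ?_
        exact ENNReal.ofReal_sum_of_nonneg fun i _ => mul_nonneg (abs_nonneg _) (hφ0 _)
    _ = ∑ i : Fin (Fintype.card n), ∫⁻ t in Set.Ioc 0 (2 * Real.pi), ENNReal.ofReal
          (|deriv (fun s => (hHerm (Function.update V e (V e * c s))).eigenvalues₀ i) t| *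
            φ ((hHerm (Function.update V e (V e * c t))).eigenvalues₀ i)) :=
        lintegral_finsetSum _ fun i _ => hmeas i
    _ ≤ _ := Finset.sum_le_sum fun i _ => lintegral_mono_set Set.Ioc_subset_Icc_self

/-- **Almost every configuration is a point of differentiability of all sorted eigenvalues along the
circle** (product Haar): the exceptional set is measurable (parametric differentiability sets are
Borel) and each circle meets it in a null set of parameters (Lebesgue's theorem, the sorted eigenvalues
being Lipschitz along circles), so it is null by the slice lemma. -/
theorem coareaWegner_ae_differentiableAlong (hmul : ∀ s t, c (s + t) = c s * c t)
    (hcont : Continuous c) (hHof : Continuous Hof)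
    (hlip : ∀ V : ι → G, ∃ K : ℝ≥0, ∀ i : Fin (Fintype.card n),
      LipschitzWith K fun s => (hHerm (Function.update V e (V e * c s))).eigenvalues₀ i) :
    ∀ᵐ V ∂(Measure.pi fun _ : ι => haarProbability G), ∀ i : Fin (Fintype.card n),
      DifferentiableAt ℝ (fun s => (hHerm (Function.update V e (V e * c s))).eigenvalues₀ i) 0 := by
  rw [ae_all_iff]
  intro i
  set Bad : Set (ι → G) := {V | ¬ DifferentiableAt ℝ
    (fun s => (hHerm (Function.update V e (V e * c s))).eigenvalues₀ i) 0} with hBad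
  have hBadm : MeasurableSet Bad := by
    have h := measurableSet_of_differentiableAt_with_param ℝ
      (f := fun (V : ι → G) (s : ℝ) => (hHerm (Function.update V e (V e * c s))).eigenvalues₀ i)
      (coareaWegner_sortedAlong_continuous e Hof hHerm hcont hHof i)
    have h2 : Bad = (fun V : ι → G => (V, (0 : ℝ))) ⁻¹'
        {p : (ι → G) × ℝ | DifferentiableAt ℝ
          (fun s => (hHerm (Function.update p.1 e (p.1 e * c s))).eigenvalues₀ i) p.2}ᶜ := by
      ext V; simp [hBad]
    rw [h2]
    exact (h.compl).preimage (measurable_id.prodMk measurable_const)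
  -- the measure of `Bad` through the slice lemma
  have hslice := coareaWegner_lintegral_pi_eq_circleAverage (G := G) e hcont.measurable
    ((measurable_one.indicator hBadm : Measurable (Bad.indicator (1 : (ι → G) → ℝ≥0∞))))
  have hinner : ∀ V : ι → G, ∫⁻ t in Set.Ioc 0 (2 * Real.pi),
      Bad.indicator (1 : (ι → G) → ℝ≥0∞) (Function.update V e (V e * c t)) = 0 := by
    intro V
    obtain ⟨K, hK⟩ := hlip V
    have hae : ∀ᵐ t : ℝ, DifferentiableAt ℝ
        (fun s => (hHerm (Function.update V e (V e * c s))).eigenvalues₀ i) t :=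
      (hK i).ae_differentiableAt_real
    refine (lintegral_eq_zero_iff' ((measurable_one.indicator hBadm).comp
      ((coareaWegner_measurable_update_mul_curve e hcont.measurable).comp
        (measurable_const.prodMk measurable_id))).aemeasurable).2 ?_
    refine ae_restrict_of_ae ?_
    filter_upwards [hae] with t ht
    have hnot : Function.update V e (V e * c t) ∉ Bad := by
      rw [hBad, Set.mem_setOf_eq, not_not, coareaWegner_sortedAlong_shift e Hof hHerm hmul V t i]
      exact (differentiableAt_comp_add_left (f := fun s =>
        (hHerm (Function.update V e (V e * c s))).eigenvalues₀ i) t).2 (by simpa using ht)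
    simp [Set.indicator_of_notMem hnot]
  have hzero : (Measure.pi fun _ : ι => haarProbability G) Bad = 0 := by
    rw [← lintegral_indicator_one hBadm]
    have : (fun V => Bad.indicator (1 : (ι → G) → ℝ≥0∞) V) = Bad.indicator 1 := rfl
    rw [hslice]
    simp_rw [hinner]
    simp
  rw [ae_iff]
  exact measure_mono_null (fun V hV => hV) hzero

/-- **The canonical majorant dominates every eigenbasis current sum, almost everywhere.**  Suppose
`J(V, ψ)` is the derivative at `s = 0` of the quadratic form `s ↦ re (ψ⋆ H(V[e ↦ V(e)c(s)]) ψ)` and the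
circle family is entrywise differentiable at `s = 0`.  Then for a.e. `V` (product Haar), for Mathlib's
eigenpairs `(u_j, λ_j)` of `H(V)`: `Σ_j |J(V, u_j)| φ(λ_j) = R_d(V)`. -/
theorem coareaWegner_majorant_ae_dominates (hc0 : c 0 = 1) (hmul : ∀ s t, c (s + t) = c s * c t)
    (hcont : Continuous c) (hHof : Continuous Hof)
    (hlip : ∀ V : ι → G, ∃ K : ℝ≥0, ∀ i : Fin (Fintype.card n),
      LipschitzWith K fun s => (hHerm (Function.update V e (V e * c s))).eigenvalues₀ i)
    (hdiffH : ∀ V : ι → G, ∃ Hd : Matrix n n ℂ, ∀ p q,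
      HasDerivAt (fun s => Hof (Function.update V e (V e * c s)) p q) (Hd p q) 0)
    (J : (ι → G) → (n → ℂ) → ℝ)
    (hJ : ∀ (V : ι → G) (ψ : n → ℂ),
      HasDerivAt (fun s => (star ψ ⬝ᵥ (Hof (Function.update V e (V e * c s))).mulVec ψ).re) (J V ψ) 0)
    (φ : ℝ → ℝ) :
    ∀ᵐ V ∂(Measure.pi fun _ : ι => haarProbability G),
      ∑ j : n, |J V ⇑((hHerm V).eigenvectorBasis j)| * φ ((hHerm V).eigenvalues j) =
        ∑ i : Fin (Fintype.card n),
          |deriv (fun s => (hHerm (Function.update V e (V e * c s))).eigenvalues₀ i) 0| *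
            φ ((hHerm V).eigenvalues₀ i) := by
  filter_upwards [coareaWegner_ae_differentiableAlong e Hof hHerm hmul hcont hHof hlip] with V hV
  set σ : n ≃ Fin (Fintype.card n) := (Fintype.equivOfCardEq (Fintype.card_fin _)).symm with hσ
  obtain ⟨Hd, hHd⟩ := hdiffH V
  have hV0 : Function.update V e (V e * c 0) = V := coareaWegner_update_zero e hc0 V
  -- the current of each eigenvector is the velocity of its sorted level
  have hkey : ∀ j : n, J V ⇑((hHerm V).eigenvectorBasis j) =
      deriv (fun s => (hHerm (Function.update V e (V e * c s))).eigenvalues₀ (σ j)) 0 := by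
    intro j
    set u : n → ℂ := ⇑((hHerm V).eigenvectorBasis j) with hu
    have h1 : J V u = (star u ⬝ᵥ Hd.mulVec u).re :=
      (hJ V u).unique (coareaWegner_rayleigh_matrix_hasDerivAt _ Hd 0 hHd u)
    rw [h1]
    refine coareaWegner_cluster_hellmannFeynman (fun s => Hof (Function.update V e (V e * c s)))
      (fun s => hHerm _) Hd 0 hHd
      (fun i => deriv (fun s => (hHerm (Function.update V e (V e * c s))).eigenvalues₀ i) 0)
      (fun i => (hV i).hasDerivAt) u (coareaWegner_star_dotProduct_eigenvectorBasis (hHerm V) j)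
      ((hHerm V).eigenvalues j) ?_ (σ j) ?_
    · show (Hof (Function.update V e (V e * c 0))).mulVec u = _
      rw [hV0]
      exact coareaWegner_mulVec_eigenvectorBasis (hHerm V) j
    · show (hHerm (Function.update V e (V e * c 0))).eigenvalues₀ (σ j) = (hHerm V).eigenvalues j
      rw [congrArg (fun V' => (hHerm V').eigenvalues₀ (σ j)) hV0]
      rfl
  have hval : ∀ j : n, (hHerm V).eigenvalues j = (hHerm V).eigenvalues₀ (σ j) := fun j => rfl
  simp_rw [hkey, hval]
  exact σ.sum_comp (fun i => |deriv (fun s => (hHerm (Function.update V e (V e * c s))).eigenvalues₀ i) 0| *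
    φ ((hHerm V).eigenvalues₀ i))

end CircleMajorant

/-- **The canonical circle majorant dominates every eigenbasis current sum, a.e.** (explicit-binder
form of `coareaWegner_majorant_ae_dominates`, the statement registered for this bridge). -/
theorem coareaWegner_circleMajorant_ae_eq {G : Type*} [Group G] [TopologicalSpace G] [IsTopologicalGroup G]
    [CompactSpace G] [MeasurableSpace G] [BorelSpace G] [SecondCountableTopology G] {ι : Type*} [Fintype ι]
    [DecidableEq ι] {n : Type*} [Fintype n] [DecidableEq n] (e : ι) {c : ℝ → G}
    (Hof : (ι → G) → Matrix n n ℂ) (hHerm : ∀ V, (Hof V).IsHermitian) (hc0 : c 0 = 1)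
    (hmul : ∀ s t, c (s + t) = c s * c t) (hcont : Continuous c) (hHof : Continuous Hof)
    (hlip : ∀ V : ι → G, ∃ K : NNReal, ∀ i : Fin (Fintype.card n),
      LipschitzWith K fun s => (hHerm (Function.update V e (V e * c s))).eigenvalues₀ i)
    (hdiffH : ∀ V : ι → G, ∃ Hd : Matrix n n ℂ, ∀ p q,
      HasDerivAt (fun s => Hof (Function.update V e (V e * c s)) p q) (Hd p q) 0)
    (J : (ι → G) → (n → ℂ) → ℝ)
    (hJ : ∀ (V : ι → G) (ψ : n → ℂ),
      HasDerivAt (fun s => (star ψ ⬝ᵥ (Hof (Function.update V e (V e * c s))).mulVec ψ).re) (J V ψ) 0)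
    (φ : ℝ → ℝ) :
    ∀ᵐ V ∂(Measure.pi fun _ : ι => haarProbability G),
      ∑ j : n, |J V ⇑((hHerm V).eigenvectorBasis j)| * φ ((hHerm V).eigenvalues j) =
        ∑ i : Fin (Fintype.card n),
          |deriv (fun s => (hHerm (Function.update V e (V e * c s))).eigenvalues₀ i) 0| *
            φ ((hHerm V).eigenvalues₀ i) :=
  coareaWegner_majorant_ae_dominates e Hof hHerm hc0 hmul hcont hHof hlip hdiffH J hJ φ

end Summit.QuantumFields.QCD.Cruxes.WegnerEstimate.ResolventCell

end
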